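import Summits.CriticalPhenomena.SAWScalingLimit.Theorems.SAWRenewalTightnessAnnularMassDecayChainStructure

/-!
# Structure of the skip mass `Skip(u;A,s)[N]` (line `radial-renewal-kesten-inequality`, stub S3)

Line `radial-renewal-kesten-inequality` of the crux `AnnularMassDecay` (stmt-CriticalPhenomena-4729),
support for the OPEN stub S3 `stub_skipTail`.  Write `ρ_u = dist (Site.toComplex u) z`, `D(u;s)[N]` for
the `x_c`-mass of the chain-stopped family at level `s` from `u` (self-avoiding `ω` of length
`0 < n ≤ N`, confined to the open disc of radius `ρ_u` about `z` after time `0`, ending at a strict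
radial record of radius `≤ s`, none of whose radial renewal times `0 < t < n` has radius `≤ s`), and
`Skip(u;A,s)[N]` for the mass of the level-`ρ_u/A` members whose END radius is `≤ s`.  S3 asserts
`Skip(u;A,ρ_u/(AB))[N] ≤ C·B^{-κ}` for `1 ≤ B`, `A·B ≤ ρ_u` (some `κ > 0`, `C`, for each `A > 1`).
All sums are spelled out over `SAW.Zd.saws`, `SAW.criticalFugacity`, `Site.toComplex`, verbatim as
registered; no definitions here.  Proved in this file (the logical position of S3 in the line):

* `rr_st_skip_le_chain` — THE LEVEL COMPARISON: for `s ≤ ρ_u/A`, `Skip(u;A,s)[N] ≤ D(u;s)[N]`.  A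
  skipping member has end radius `≤ s` and no renewal of radius `≤ ρ_u/A`, a fortiori none of radius
  `≤ s`: it is a member AT LEVEL `s` (not merely at level `ρ_u/A`).  So the skip family of the first
  `A`-descent is a sub-family of the very family `D(u;s)` the line's induction bounds.
* `rr_st_skipTail_of_chainDecay` (registered helper) — consequently the line's target `ChainDecay`
  (`D(u;r)[N] ≤ C (r/ρ_u)^θ` for `1 ≤ r < ρ_u`, the conclusion of `stub_chainDecay`) IMPLIES S3 with
  `κ = θ`: take `r = ρ_u/(AB) ≥ 1`, so `(r/ρ_u)^θ = (AB)^{-θ} ≤ B^{-θ}`.  Together with S5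
  (`S4 ∧ S1 ∧ S2 ∧ S3 → ChainDecay`, landed) this shows that, GIVEN S1, S2 and S4, the stub S3 is
  EQUIVALENT to `ChainDecay`: S3 carries the full open "decay with a rate" content of the line and is
  not weaker than the line's target restricted to its sub-family.
* `rr_st_chainBounded_of_skipTail` — conversely S3 at `B = 1` is the S1-type boundedness
  `D(u;ρ_u/A)[N] ≤ C` for `ρ_u ≥ A` (the two families coincide): the bounded-`B` regime of S3 is not
  free either.
* `rr_st_stable`, `rr_st_le_stable` — STABILISATION in the truncation: `Skip(u;A,s)[N]` is constant
  for `N ≥ N₀ := (2⌈ρ_u⌉₊ + 3)²` and bounded by its value there (members are confined to the open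
  disc, `rr_cb_length_le`), so `∀ N` in S3 is the single value `N₀(u,z)`.

Sources: H. Kesten, J. Math. Phys. 4 (1963) (irreducible bridges); N. Madras, G. Slade,
*The Self-Avoiding Walk* (1993) §4.2. [folklore]
-/

noncomputable section

namespace Summit.CriticalPhenomena.SAWScalingLimit.Theorems.AnnularMassDecay.Radial

open scoped BigOperators Classical
open Literature.Probability.LatticeModels Literature.Probability.RandomPlanarGeometry
open Summit.CriticalPhenomena.SAWScalingLimit.Theorems.AnnularMassDecay.Negative (criticalFugacity_pos)

/-! ### The level comparison -/

/-- **Skipping members are level-`s` members, on profiles.** If a radius profile satisfies the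
skip clauses at renewal level `L` with end radius `≤ s` and `s ≤ L`, it satisfies the chain
clauses at level `s`. [folklore] -/
theorem rr_st_profile_chain_of_skip {r : ℕ → ℝ} {ρ s L : ℝ} {n : ℕ} (hsL : s ≤ L)
    (h : r n ≤ s ∧ 0 < n ∧ (∀ i, 0 < i → i ≤ n → r i < ρ) ∧ (∀ i, i < n → r n < r i) ∧ r n ≤ L ∧
      (∀ t, 0 < t → t < n → (∀ i, i < t → r t < r i) →
        (∀ j, t < j → j ≤ n → r j < r t) → L < r t)) :
    0 < n ∧ (∀ i, 0 < i → i ≤ n → r i < ρ) ∧ (∀ i, i < n → r n < r i) ∧ r n ≤ s ∧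
      (∀ t, 0 < t → t < n → (∀ i, i < t → r t < r i) →
        (∀ j, t < j → j ≤ n → r j < r t) → s < r t) := by
  obtain ⟨hns, hn, hconf, hrec, -, hren⟩ := h
  exact ⟨hn, hconf, hrec, hns, fun t ht0 htn hR hF => lt_of_le_of_lt hsL (hren t ht0 htn hR hF)⟩

/-- **The level comparison.** For `s ≤ dist (Site.toComplex u) z / A` the skip mass is bounded by
the chain-stopped mass AT LEVEL `s`: `Skip(u;A,s)[N] ≤ D(u;s)[N]` (a skipping member has end radius
`≤ s` and no renewal of radius `≤ dist (Site.toComplex u) z / A ≥ s` before its end). [folklore] -/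
theorem rr_st_skip_le_chain (A : ℝ) (z : ℂ) (u : Site 2) (s : ℝ)
    (hs : s ≤ dist (Site.toComplex u) z / A) (N : ℕ) :
    (∑ n ∈ Finset.range (N + 1),
        ∑ _ω ∈ (SAW.Zd.saws 2 n).filter (fun ω =>
          dist (Site.toComplex (u + ω n)) z ≤ s ∧
          0 < n ∧
          (∀ i, 0 < i → i ≤ n → dist (Site.toComplex (u + ω i)) z < dist (Site.toComplex u) z) ∧
          (∀ i, i < n → dist (Site.toComplex (u + ω n)) z < dist (Site.toComplex (u + ω i)) z) ∧
          dist (Site.toComplex (u + ω n)) z ≤ dist (Site.toComplex u) z / A ∧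
          (∀ t, 0 < t → t < n →
            (∀ i, i < t → dist (Site.toComplex (u + ω t)) z < dist (Site.toComplex (u + ω i)) z) →
            (∀ j, t < j → j ≤ n → dist (Site.toComplex (u + ω j)) z < dist (Site.toComplex (u + ω t)) z) →
            dist (Site.toComplex u) z / A < dist (Site.toComplex (u + ω t)) z)),
          SAW.criticalFugacity ^ n) ≤
      ∑ n ∈ Finset.range (N + 1),
        ∑ _ω ∈ (SAW.Zd.saws 2 n).filter (fun ω =>
          0 < n ∧
          (∀ i, 0 < i → i ≤ n → dist (Site.toComplex (u + ω i)) z < dist (Site.toComplex u) z) ∧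
          (∀ i, i < n → dist (Site.toComplex (u + ω n)) z < dist (Site.toComplex (u + ω i)) z) ∧
          dist (Site.toComplex (u + ω n)) z ≤ s ∧
          (∀ t, 0 < t → t < n →
            (∀ i, i < t → dist (Site.toComplex (u + ω t)) z < dist (Site.toComplex (u + ω i)) z) →
            (∀ j, t < j → j ≤ n → dist (Site.toComplex (u + ω j)) z < dist (Site.toComplex (u + ω t)) z) →
            s < dist (Site.toComplex (u + ω t)) z)),
          SAW.criticalFugacity ^ n := by
  refine Finset.sum_le_sum fun n _ => ?_
  refine Finset.sum_le_sum_of_subset_of_nonneg ?_ fun _ _ _ => pow_nonneg criticalFugacity_pos.le n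
  intro ω hω
  rw [Finset.mem_filter] at hω ⊢
  exact ⟨hω.1, rr_st_profile_chain_of_skip (r := fun i => dist (Site.toComplex (u + ω i)) z) hs hω.2⟩

/-! ### `ChainDecay` implies S3 -/

/-- **`ChainDecay ⟹ SkipTail`** (registered helper `rr_st_skipTail_of_chainDecay` for
`stub_skipTail`).  If `D(u;r)[N] ≤ C (r / dist (Site.toComplex u) z)^θ` for all `1 ≤ r <
dist (Site.toComplex u) z` (the conclusion `ChainDecay` of the line, verbatim), then for every
`A > 1` the skip tail holds with `κ = θ` and constant `max C 0`: for `1 ≤ B`,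
`A·B ≤ dist (Site.toComplex u) z`, the level `r = dist (Site.toComplex u) z / (A·B)` has `1 ≤ r <
dist (Site.toComplex u) z`, the skip mass is at most `D(u;r)[N]` (`rr_st_skip_le_chain`), and
`(r / dist (Site.toComplex u) z)^θ = (A·B)^{-θ} ≤ B^{-θ}`.  With S5 (landed) S3 is therefore
equivalent to `ChainDecay` given S1, S2, S4. [folklore] -/
theorem rr_st_skipTail_of_chainDecay :
    (∃ θ C : ℝ, 0 < θ ∧ ∀ (z : ℂ) (u : Site 2) (r : ℝ), 1 ≤ r → r < dist (Site.toComplex u) z → ∀ N : ℕ,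
      (∑ n ∈ Finset.range (N + 1),
        ∑ _ω ∈ (SAW.Zd.saws 2 n).filter (fun ω =>
          0 < n ∧
          (∀ i, 0 < i → i ≤ n → dist (Site.toComplex (u + ω i)) z < dist (Site.toComplex u) z) ∧
          (∀ i, i < n → dist (Site.toComplex (u + ω n)) z < dist (Site.toComplex (u + ω i)) z) ∧
          dist (Site.toComplex (u + ω n)) z ≤ r ∧
          (∀ t, 0 < t → t < n →
            (∀ i, i < t → dist (Site.toComplex (u + ω t)) z < dist (Site.toComplex (u + ω i)) z) →
            (∀ j, t < j → j ≤ n → dist (Site.toComplex (u + ω j)) z < dist (Site.toComplex (u + ω t)) z) →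
            r < dist (Site.toComplex (u + ω t)) z)),
          SAW.criticalFugacity ^ n) ≤ C * (r / dist (Site.toComplex u) z) ^ θ) →
    ∀ A : ℝ, 1 < A → ∃ κ C : ℝ, 0 < κ ∧ ∀ B : ℝ, 1 ≤ B → ∀ (z : ℂ) (u : Site 2),
      A * B ≤ dist (Site.toComplex u) z → ∀ N : ℕ,
      (∑ n ∈ Finset.range (N + 1),
        ∑ _ω ∈ (SAW.Zd.saws 2 n).filter (fun ω =>
          dist (Site.toComplex (u + ω n)) z ≤ dist (Site.toComplex u) z / (A * B) ∧
          0 < n ∧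
          (∀ i, 0 < i → i ≤ n → dist (Site.toComplex (u + ω i)) z < dist (Site.toComplex u) z) ∧
          (∀ i, i < n → dist (Site.toComplex (u + ω n)) z < dist (Site.toComplex (u + ω i)) z) ∧
          dist (Site.toComplex (u + ω n)) z ≤ dist (Site.toComplex u) z / A ∧
          (∀ t, 0 < t → t < n →
            (∀ i, i < t → dist (Site.toComplex (u + ω t)) z < dist (Site.toComplex (u + ω i)) z) →
            (∀ j, t < j → j ≤ n → dist (Site.toComplex (u + ω j)) z < dist (Site.toComplex (u + ω t)) z) →
            dist (Site.toComplex u) z / A < dist (Site.toComplex (u + ω t)) z)),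
          SAW.criticalFugacity ^ n) ≤ C * B ^ (-κ) := by
  rintro ⟨θ, C, hθ, hD⟩ A hA
  refine ⟨θ, max C 0, hθ, fun B hB z u hAB N => ?_⟩
  have hABpos : 0 < A * B := by positivity
  have hB0 : 0 < B := by linarith
  have hρpos : 0 < dist (Site.toComplex u) z := lt_of_lt_of_le hABpos hAB
  have hAB1 : 1 < A * B := by nlinarith
  have hs1 : 1 ≤ dist (Site.toComplex u) z / (A * B) := by rwa [le_div_iff₀ hABpos, one_mul]
  have hslt : dist (Site.toComplex u) z / (A * B) < dist (Site.toComplex u) z :=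
    div_lt_self hρpos hAB1
  have hsle : dist (Site.toComplex u) z / (A * B) ≤ dist (Site.toComplex u) z / A :=
    div_le_div_of_nonneg_left hρpos.le (by linarith) (by nlinarith)
  have key := hD z u (dist (Site.toComplex u) z / (A * B)) hs1 hslt N
  refine (rr_st_skip_le_chain A z u _ hsle N).trans (key.trans ?_)
  have hq : dist (Site.toComplex u) z / (A * B) / dist (Site.toComplex u) z = (A * B)⁻¹ := by
    field_simp
  rw [hq, Real.inv_rpow hABpos.le, ← Real.rpow_neg hABpos.le]
  calc C * (A * B) ^ (-θ) ≤ max C 0 * (A * B) ^ (-θ) :=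
        mul_le_mul_of_nonneg_right (le_max_left _ _) (Real.rpow_nonneg hABpos.le _)
    _ ≤ max C 0 * B ^ (-θ) :=
        mul_le_mul_of_nonneg_left
          (Real.rpow_le_rpow_of_nonpos hB0 (by nlinarith) (by linarith)) (le_max_right _ _)

/-! ### S3 at `B = 1` is boundedness at level `dist (Site.toComplex u) z / A` -/

/-- **`SkipTail ⟹` boundedness of `D(u; ρ_u/A)` for `ρ_u ≥ A`.** At `B = 1` the skip family IS the
level-`dist (Site.toComplex u) z / A` chain family (the extra end clause is the level clause), so S3
gives `D(u; dist (Site.toComplex u) z / A)[N] ≤ C` whenever `A ≤ dist (Site.toComplex u) z`: the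
bounded-`B` end of S3 is an S1-type statement, not a triviality. [folklore] -/
theorem rr_st_chainBounded_of_skipTail
    (h : ∀ A : ℝ, 1 < A → ∃ κ C : ℝ, 0 < κ ∧ ∀ B : ℝ, 1 ≤ B → ∀ (z : ℂ) (u : Site 2),
      A * B ≤ dist (Site.toComplex u) z → ∀ N : ℕ,
      (∑ n ∈ Finset.range (N + 1),
        ∑ _ω ∈ (SAW.Zd.saws 2 n).filter (fun ω =>
          dist (Site.toComplex (u + ω n)) z ≤ dist (Site.toComplex u) z / (A * B) ∧
          0 < n ∧
          (∀ i, 0 < i → i ≤ n → dist (Site.toComplex (u + ω i)) z < dist (Site.toComplex u) z) ∧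
          (∀ i, i < n → dist (Site.toComplex (u + ω n)) z < dist (Site.toComplex (u + ω i)) z) ∧
          dist (Site.toComplex (u + ω n)) z ≤ dist (Site.toComplex u) z / A ∧
          (∀ t, 0 < t → t < n →
            (∀ i, i < t → dist (Site.toComplex (u + ω t)) z < dist (Site.toComplex (u + ω i)) z) →
            (∀ j, t < j → j ≤ n → dist (Site.toComplex (u + ω j)) z < dist (Site.toComplex (u + ω t)) z) →
            dist (Site.toComplex u) z / A < dist (Site.toComplex (u + ω t)) z)),
          SAW.criticalFugacity ^ n) ≤ C * B ^ (-κ))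
    (A : ℝ) (hA : 1 < A) :
    ∃ C : ℝ, ∀ (z : ℂ) (u : Site 2), A ≤ dist (Site.toComplex u) z → ∀ N : ℕ,
      (∑ n ∈ Finset.range (N + 1),
        ∑ _ω ∈ (SAW.Zd.saws 2 n).filter (fun ω =>
          0 < n ∧
          (∀ i, 0 < i → i ≤ n → dist (Site.toComplex (u + ω i)) z < dist (Site.toComplex u) z) ∧
          (∀ i, i < n → dist (Site.toComplex (u + ω n)) z < dist (Site.toComplex (u + ω i)) z) ∧
          dist (Site.toComplex (u + ω n)) z ≤ dist (Site.toComplex u) z / A ∧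
          (∀ t, 0 < t → t < n →
            (∀ i, i < t → dist (Site.toComplex (u + ω t)) z < dist (Site.toComplex (u + ω i)) z) →
            (∀ j, t < j → j ≤ n → dist (Site.toComplex (u + ω j)) z < dist (Site.toComplex (u + ω t)) z) →
            dist (Site.toComplex u) z / A < dist (Site.toComplex (u + ω t)) z)),
          SAW.criticalFugacity ^ n) ≤ C := by
  obtain ⟨κ, C, -, hC⟩ := h A hA
  refine ⟨C * (1 : ℝ) ^ (-κ), fun z u hu N => ?_⟩
  refine le_trans (le_of_eq ?_) (hC 1 le_rfl z u (by rwa [mul_one]) N)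
  refine Finset.sum_congr rfl fun n _ => Finset.sum_congr (Finset.filter_congr fun ω _ => ?_)
    fun _ _ => rfl
  rw [mul_one]
  constructor
  · rintro ⟨hn, hconf, hrec, hend, hren⟩
    exact ⟨hend, hn, hconf, hrec, hend, hren⟩
  · rintro ⟨-, h⟩
    exact h

/-! ### Stabilisation in the truncation -/

/-- **Stabilisation of the skip mass.** For `N ≥ N₀ := (2⌈dist (Site.toComplex u) z⌉₊ + 3)²` the
partial sum `Skip(u;A,s)[N]` equals `Skip(u;A,s)[N₀]`: a skipping member is confined to the open disc
of radius `dist (Site.toComplex u) z` about `z` at the times `1, …, n`, so `n ≤ N₀`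
(`rr_cb_length_le`).  Hence `∀ N` in S3 is the single value `N₀(u,z)`. [folklore] -/
theorem rr_st_stable (A : ℝ) (z : ℂ) (u : Site 2) (s : ℝ) (N : ℕ)
    (hN : (2 * ⌈dist (Site.toComplex u) z⌉₊ + 3) ^ 2 ≤ N) :
    (∑ n ∈ Finset.range (N + 1),
        ∑ _ω ∈ (SAW.Zd.saws 2 n).filter (fun ω =>
          dist (Site.toComplex (u + ω n)) z ≤ s ∧
          0 < n ∧
          (∀ i, 0 < i → i ≤ n → dist (Site.toComplex (u + ω i)) z < dist (Site.toComplex u) z) ∧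
          (∀ i, i < n → dist (Site.toComplex (u + ω n)) z < dist (Site.toComplex (u + ω i)) z) ∧
          dist (Site.toComplex (u + ω n)) z ≤ dist (Site.toComplex u) z / A ∧
          (∀ t, 0 < t → t < n →
            (∀ i, i < t → dist (Site.toComplex (u + ω t)) z < dist (Site.toComplex (u + ω i)) z) →
            (∀ j, t < j → j ≤ n → dist (Site.toComplex (u + ω j)) z < dist (Site.toComplex (u + ω t)) z) →
            dist (Site.toComplex u) z / A < dist (Site.toComplex (u + ω t)) z)),
          SAW.criticalFugacity ^ n) =
      ∑ n ∈ Finset.range ((2 * ⌈dist (Site.toComplex u) z⌉₊ + 3) ^ 2 + 1),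
        ∑ _ω ∈ (SAW.Zd.saws 2 n).filter (fun ω =>
          dist (Site.toComplex (u + ω n)) z ≤ s ∧
          0 < n ∧
          (∀ i, 0 < i → i ≤ n → dist (Site.toComplex (u + ω i)) z < dist (Site.toComplex u) z) ∧
          (∀ i, i < n → dist (Site.toComplex (u + ω n)) z < dist (Site.toComplex (u + ω i)) z) ∧
          dist (Site.toComplex (u + ω n)) z ≤ dist (Site.toComplex u) z / A ∧
          (∀ t, 0 < t → t < n →
            (∀ i, i < t → dist (Site.toComplex (u + ω t)) z < dist (Site.toComplex (u + ω i)) z) →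
            (∀ j, t < j → j ≤ n → dist (Site.toComplex (u + ω j)) z < dist (Site.toComplex (u + ω t)) z) →
            dist (Site.toComplex u) z / A < dist (Site.toComplex (u + ω t)) z)),
          SAW.criticalFugacity ^ n := by
  symm
  refine Finset.sum_subset (Finset.range_mono (by omega)) fun n hn hn' => ?_
  rw [Finset.mem_range] at hn hn'
  refine Finset.sum_eq_zero fun ω hω => ?_
  exfalso
  obtain ⟨hsaw, -, -, hconf, -⟩ := Finset.mem_filter.1 hω
  have := rr_cb_length_le hsaw hconf
  omega

/-- Consequently every partial skip sum is bounded by the stable one: `Skip(u;A,s)[N] ≤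
Skip(u;A,s)[N₀]` with `N₀ = (2⌈dist (Site.toComplex u) z⌉₊ + 3)²`. [folklore] -/
theorem rr_st_le_stable (A : ℝ) (z : ℂ) (u : Site 2) (s : ℝ) (N : ℕ) :
    (∑ n ∈ Finset.range (N + 1),
        ∑ _ω ∈ (SAW.Zd.saws 2 n).filter (fun ω =>
          dist (Site.toComplex (u + ω n)) z ≤ s ∧
          0 < n ∧
          (∀ i, 0 < i → i ≤ n → dist (Site.toComplex (u + ω i)) z < dist (Site.toComplex u) z) ∧
          (∀ i, i < n → dist (Site.toComplex (u + ω n)) z < dist (Site.toComplex (u + ω i)) z) ∧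
          dist (Site.toComplex (u + ω n)) z ≤ dist (Site.toComplex u) z / A ∧
          (∀ t, 0 < t → t < n →
            (∀ i, i < t → dist (Site.toComplex (u + ω t)) z < dist (Site.toComplex (u + ω i)) z) →
            (∀ j, t < j → j ≤ n → dist (Site.toComplex (u + ω j)) z < dist (Site.toComplex (u + ω t)) z) →
            dist (Site.toComplex u) z / A < dist (Site.toComplex (u + ω t)) z)),
          SAW.criticalFugacity ^ n) ≤
      ∑ n ∈ Finset.range ((2 * ⌈dist (Site.toComplex u) z⌉₊ + 3) ^ 2 + 1),
        ∑ _ω ∈ (SAW.Zd.saws 2 n).filter (fun ω =>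
          dist (Site.toComplex (u + ω n)) z ≤ s ∧
          0 < n ∧
          (∀ i, 0 < i → i ≤ n → dist (Site.toComplex (u + ω i)) z < dist (Site.toComplex u) z) ∧
          (∀ i, i < n → dist (Site.toComplex (u + ω n)) z < dist (Site.toComplex (u + ω i)) z) ∧
          dist (Site.toComplex (u + ω n)) z ≤ dist (Site.toComplex u) z / A ∧
          (∀ t, 0 < t → t < n →
            (∀ i, i < t → dist (Site.toComplex (u + ω t)) z < dist (Site.toComplex (u + ω i)) z) →
            (∀ j, t < j → j ≤ n → dist (Site.toComplex (u + ω j)) z < dist (Site.toComplex (u + ω t)) z) →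
            dist (Site.toComplex u) z / A < dist (Site.toComplex (u + ω t)) z)),
          SAW.criticalFugacity ^ n := by
  rcases le_or_gt ((2 * ⌈dist (Site.toComplex u) z⌉₊ + 3) ^ 2) N with h | h
  · exact (rr_st_stable A z u s N h).le
  · exact Finset.sum_le_sum_of_subset_of_nonneg (Finset.range_mono (by omega))
      fun n _ _ => Finset.sum_nonneg fun _ _ => pow_nonneg criticalFugacity_pos.le n

end Summit.CriticalPhenomena.SAWScalingLimit.Theorems.AnnularMassDecay.Radial

end
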